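import Summits.Ventures.PercRepro.C041RcPortTheoremR
import Summits.Ventures.PercRepro.C041ZonePortCSLemma

/-!
# THEOREM R-CS ON SKELETONS: CONJECTURE (CS) on the red-connected-attachment family `𝒮_rc(O)` (p6, gen 28;
mine-3, C-041.md §17 (a) «consequently (CS) holds on `𝒮_rc(O)` for every `O`»)

Setting of `C041RcPortCountSum` / `C041RcPortTheoremR` (gen 24): a skeleton with an edge between the terminals
(`12 ∈ E`), the probe `c` not adjacent to a terminal, `c ≠ a, b`, `a ≠ b`; the sources `𝒮_rc(O)` with bare colouring
`O` are the configurations of `rcSrcSet`, grouped into the FIBRES of their pattern on the zone port problem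
`rcPort`; every fibre of a valid pattern has the same size `N` and the other fibres are empty (`card_rcFibre_eq`,
`rcFibre_eq_empty`), and the Good bits of a source are the Good bits of its pattern (`rc_good_a_iff`,
`rc_good_b_iff`).  So `#𝒮_rc(O) = N·#valid`, `#Good_a = N·#Good₁`, `#Good_b = N·#Good₂` (`exists_fibre_size`,
`card_rcSrcSet_eq_mul`, `card_rcGoodA_eq_mul`, `card_rcGoodB_eq_mul`), and (CS) — homogeneous of degree two
(`cs_mul`) — transfers from THEOREM R-CS on the port problem (`csOr_of_zonesReached`):

* **`rc_cs_of_bare`** — for every bare colouring `O`: `(#𝒮_rc(O) − #Good_a − #Good_b)₊² ≤ #Good_a · #Good_b`;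
* **`rc_cs`** — summed over the colourings (the CAUCHY–SCHWARZ sum `cs_of_fibres` along `bareOf`), for the sources
  `rcSrcAll` all of whose attached zones are rc, on every skeleton with `12 ∈ E`, `c ≠ a, b`, `a ≠ b`: with the
  probe adjacent to a terminal every source is Good on one fixed side (`good_of_adj`), so (CS) is immediate there.
-/

namespace PercRepro

namespace MultiGraph

open Finset ZonePort CSCount

variable {V E : Type*} {G : MultiGraph V E}

/-- **(CS) is homogeneous of degree two.** -/
theorem cs_mul {v x y : ℕ} (N : ℕ) (h : CS v x y) : CS (N * v) (N * x) (N * y) := by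
  unfold CS at h ⊢
  have e : N * v - N * x - N * y = N * (v - x - y) := by
    rw [Nat.mul_sub, Nat.mul_sub]
  rw [e]
  calc (N * (v - x - y)) ^ 2 = N ^ 2 * (v - x - y) ^ 2 := by ring
    _ ≤ N ^ 2 * (x * y) := Nat.mul_le_mul_left _ h
    _ = N * x * (N * y) := by ring

section PerColouring

variable [Fintype V] [Fintype E] [DecidableEq E] {a b c : V} (hca : c ≠ a) (hcb : c ≠ b)
  (hc : ∀ e, ¬ G.Joins e c a ∧ ¬ G.Joins e c b) (hne : a ≠ b) (habE : ∃ e, G.Joins e a b) (O : Config E)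

open Classical in
/-- The sources of `𝒮_rc(O)` with `Good_a` (`b` red-reachable from the probe avoiding the blue cluster of `a`). -/
noncomputable def rcGoodA (G : MultiGraph V E) (a b c : V) (O : Config E) : Finset (Config E) :=
  (G.rcSrcSet a b c O).filter fun S => G.WalkAvoiding S (G.cluster Sᶜ a) c b

open Classical in
/-- The sources of `𝒮_rc(O)` with `Good_b`. -/
noncomputable def rcGoodB (G : MultiGraph V E) (a b c : V) (O : Config E) : Finset (Config E) :=
  (G.rcSrcSet a b c O).filter fun S => G.WalkAvoiding S (G.cluster Sᶜ b) c a

/-- Membership in `𝒮_rc(O)`. -/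
theorem mem_rcSrcSet {S : Config E} : S ∈ G.rcSrcSet a b c O ↔ G.IsRcSrc a b c O S := by
  classical
  unfold rcSrcSet
  rw [mem_filter]
  exact and_iff_right (mem_univ _)

/-- Membership in the `Good_a` sources. -/
theorem mem_rcGoodA {S : Config E} :
    S ∈ G.rcGoodA a b c O ↔ G.IsRcSrc a b c O S ∧ G.WalkAvoiding S (G.cluster Sᶜ a) c b := by
  classical
  unfold rcGoodA
  rw [mem_filter, mem_rcSrcSet]

/-- Membership in the `Good_b` sources. -/
theorem mem_rcGoodB {S : Config E} :
    S ∈ G.rcGoodB a b c O ↔ G.IsRcSrc a b c O S ∧ G.WalkAvoiding S (G.cluster Sᶜ b) c a := by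
  classical
  unfold rcGoodB
  rw [mem_filter, mem_rcSrcSet]

omit [Fintype E] [DecidableEq E] in
include hca hcb hc hne in
/-- **`Good_a` of a source is `Good₁` of its pattern.** -/
theorem goodA_iff_of_rcSrc {S : Config E} (hS : G.IsRcSrc a b c O S) :
    G.WalkAvoiding S (G.cluster Sᶜ a) c b ↔ (G.rcPort a b c O hca hcb hc).Good₁ (rcPattern hca hcb hc S) := by
  obtain ⟨hagree, hrc, _, hca', _, hab'⟩ := hS
  exact rc_good_a_iff hca hcb hc hne hagree (rc_terminal_red_of_not_conn hab') (noDoubleZone_of_not_conn hagree hab')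
    hrc (rc_c_not_mem_cluster_a hca')

omit [Fintype E] [DecidableEq E] in
include hca hcb hc hne in
/-- **`Good_b` of a source is `Good₂` of its pattern.** -/
theorem goodB_iff_of_rcSrc {S : Config E} (hS : G.IsRcSrc a b c O S) :
    G.WalkAvoiding S (G.cluster Sᶜ b) c a ↔ (G.rcPort a b c O hca hcb hc).Good₂ (rcPattern hca hcb hc S) := by
  obtain ⟨hagree, hrc, _, _, hcb', hab'⟩ := hS
  exact rc_good_b_iff hca hcb hc hne hagree (rc_terminal_red_of_not_conn hab') (noDoubleZone_of_not_conn hagree hab')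
    hrc (rc_c_not_mem_cluster_b hcb')

omit [Fintype E] [DecidableEq E] in
include hca hcb hc hne habE in
/-- A source has a valid pattern. -/
theorem validOr_of_rcSrc {S : Config E} (hS : G.IsRcSrc a b c O S) :
    (G.rcPort a b c O hca hcb hc).ValidOr (rcPattern hca hcb hc S) :=
  adm_valid_of_rcSrc hca hcb hc hne habE hS

include hca hcb hc hne habE in
open Classical in
/-- **The fibre sizes**: some `N` is the size of every fibre of a valid pattern, the other fibres being empty. -/
theorem exists_fibre_size : ∃ N : ℕ, ∀ x : (G.rcPort a b c O hca hcb hc).Term → Bool,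
    #(rcFibre hca hcb hc O x) = if (G.rcPort a b c O hca hcb hc).ValidOr x then N else 0 := by
  by_cases hex : ∃ x₀ : (G.rcPort a b c O hca hcb hc).Term → Bool, (G.rcPort a b c O hca hcb hc).ValidOr x₀
  · obtain ⟨x₀, hx₀⟩ := hex
    refine ⟨#(rcFibre hca hcb hc O x₀), fun x => ?_⟩
    by_cases hx : (G.rcPort a b c O hca hcb hc).ValidOr x
    · rw [if_pos hx]
      exact card_rcFibre_eq hca hcb hc hne habE O hx hx₀
    · rw [if_neg hx, rcFibre_eq_empty hca hcb hc hne habE O hx, card_empty]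
  · refine ⟨0, fun x => ?_⟩
    have hx : ¬ (G.rcPort a b c O hca hcb hc).ValidOr x := fun h => hex ⟨x, h⟩
    rw [if_neg hx, rcFibre_eq_empty hca hcb hc hne habE O hx, card_empty]

include hne in
open Classical in
/-- The fibre of `x` among the `Good_a` sources is the fibre of `x` when `Good₁ x`, empty otherwise. -/
theorem card_rcGoodA_fibre (x : (G.rcPort a b c O hca hcb hc).Term → Bool) :
    #((G.rcGoodA a b c O).filter fun S => rcPattern hca hcb hc S = x) =
      if (G.rcPort a b c O hca hcb hc).Good₁ x then #(rcFibre hca hcb hc O x) else 0 := by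
  split_ifs with hg
  · congr 1
    ext S
    rw [mem_filter, mem_rcGoodA, mem_rcFibre]
    constructor
    · rintro ⟨⟨hS, _⟩, hx⟩
      exact ⟨hS, hx⟩
    · rintro ⟨hS, hx⟩
      refine ⟨⟨hS, (goodA_iff_of_rcSrc hca hcb hc hne O hS).2 ?_⟩, hx⟩
      rw [hx]
      exact hg
  · rw [card_eq_zero, Finset.eq_empty_iff_forall_notMem]
    intro S hS
    rw [mem_filter, mem_rcGoodA] at hS
    obtain ⟨⟨hS, hgA⟩, hx⟩ := hS
    apply hg
    rw [← hx]
    exact (goodA_iff_of_rcSrc hca hcb hc hne O hS).1 hgA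

include hne in
open Classical in
/-- The fibre of `x` among the `Good_b` sources is the fibre of `x` when `Good₂ x`, empty otherwise. -/
theorem card_rcGoodB_fibre (x : (G.rcPort a b c O hca hcb hc).Term → Bool) :
    #((G.rcGoodB a b c O).filter fun S => rcPattern hca hcb hc S = x) =
      if (G.rcPort a b c O hca hcb hc).Good₂ x then #(rcFibre hca hcb hc O x) else 0 := by
  split_ifs with hg
  · congr 1
    ext S
    rw [mem_filter, mem_rcGoodB, mem_rcFibre]
    constructor
    · rintro ⟨⟨hS, _⟩, hx⟩
      exact ⟨hS, hx⟩
    · rintro ⟨hS, hx⟩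
      refine ⟨⟨hS, (goodB_iff_of_rcSrc hca hcb hc hne O hS).2 ?_⟩, hx⟩
      rw [hx]
      exact hg
  · rw [card_eq_zero, Finset.eq_empty_iff_forall_notMem]
    intro S hS
    rw [mem_filter, mem_rcGoodB] at hS
    obtain ⟨⟨hS, hgB⟩, hx⟩ := hS
    apply hg
    rw [← hx]
    exact (goodB_iff_of_rcSrc hca hcb hc hne O hS).1 hgB

open Classical in
/-- The fibre of `x` among all sources is `rcFibre x`. -/
theorem card_rcSrcSet_fibre (x : (G.rcPort a b c O hca hcb hc).Term → Bool) :
    #((G.rcSrcSet a b c O).filter fun S => rcPattern hca hcb hc S = x) = #(rcFibre hca hcb hc O x) := by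
  apply congrArg Finset.card
  ext S
  rw [mem_filter, mem_rcSrcSet, mem_rcFibre]

include hca hcb hc hne habE in
open Classical in
/-- **`#𝒮_rc(O) = N · #valid`, `#Good_a = N · #Good₁`, `#Good_b = N · #Good₂`** for the fibre size `N`. -/
theorem exists_counts_eq_mul : ∃ N : ℕ,
    #(G.rcSrcSet a b c O) = N * #((G.rcPort a b c O hca hcb hc).validSet) ∧
    #(G.rcGoodA a b c O) = N * #((G.rcPort a b c O hca hcb hc).good₁Set) ∧
    #(G.rcGoodB a b c O) = N * #((G.rcPort a b c O hca hcb hc).good₂Set) := by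
  obtain ⟨N, hN⟩ := exists_fibre_size hca hcb hc hne habE O
  refine ⟨N, ?_, ?_, ?_⟩
  · rw [card_eq_sum_card_fiberwise (f := rcPattern hca hcb hc) (t := univ) fun _ _ => mem_univ _,
      Finset.sum_congr rfl fun x _ => (card_rcSrcSet_fibre hca hcb hc O x).trans (hN x), ← Finset.sum_filter,
      Finset.sum_const, smul_eq_mul, mul_comm]
    rfl
  · rw [card_eq_sum_card_fiberwise (f := rcPattern hca hcb hc) (t := univ) fun _ _ => mem_univ _,
      Finset.sum_congr rfl fun x _ => (card_rcGoodA_fibre hca hcb hc hne O x).trans (by rw [hN x]),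
      ← Finset.sum_filter, ← Finset.sum_filter, Finset.sum_const, smul_eq_mul, mul_comm]
    congr 2
    ext x
    rw [mem_filter, mem_filter, Problem.mem_good₁Set]
    constructor
    · rintro ⟨⟨_, hg⟩, hv⟩
      exact ⟨hv, hg⟩
    · rintro ⟨hv, hg⟩
      exact ⟨⟨mem_univ _, hg⟩, hv⟩
  · rw [card_eq_sum_card_fiberwise (f := rcPattern hca hcb hc) (t := univ) fun _ _ => mem_univ _,
      Finset.sum_congr rfl fun x _ => (card_rcGoodB_fibre hca hcb hc hne O x).trans (by rw [hN x]),
      ← Finset.sum_filter, ← Finset.sum_filter, Finset.sum_const, smul_eq_mul, mul_comm]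
    congr 2
    ext x
    rw [mem_filter, mem_filter, Problem.mem_good₂Set]
    constructor
    · rintro ⟨⟨_, hg⟩, hv⟩
      exact ⟨hv, hg⟩
    · rintro ⟨hv, hg⟩
      exact ⟨⟨mem_univ _, hg⟩, hv⟩

include hca hcb hc hne habE in
open Classical in
/-- **THEOREM R-CS ON SKELETONS, per colouring** (mine-3, C-041.md §17 (a)): on every skeleton with an edge between
the terminals, the probe not adjacent to a terminal, `c ≠ a, b` and `a ≠ b`, for every bare colouring `O`,
`(#𝒮_rc(O) − #Good_a − #Good_b)₊² ≤ #Good_a · #Good_b`. -/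
theorem rc_cs_of_bare : CS #(G.rcSrcSet a b c O) #(G.rcGoodA a b c O) #(G.rcGoodB a b c O) := by
  obtain ⟨N, h1, h2, h3⟩ := exists_counts_eq_mul hca hcb hc hne habE O
  rw [h1, h2, h3]
  exact cs_mul N (Problem.csOr_of_zonesReached _ (rcPort_zonesReached hca hcb hc))

end PerColouring

section All

variable [Fintype V] [Fintype E] [DecidableEq E] (a b c : V)

open Classical in
/-- The sources of the rc family with `Good_a` (all bare colourings). -/
noncomputable def rcGoodAAll (G : MultiGraph V E) (a b c : V) : Finset (Config E) :=
  (G.rcSrcAll a b c).filter fun S => G.WalkAvoiding S (G.cluster Sᶜ a) c b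

open Classical in
/-- The sources of the rc family with `Good_b` (all bare colourings). -/
noncomputable def rcGoodBAll (G : MultiGraph V E) (a b c : V) : Finset (Config E) :=
  (G.rcSrcAll a b c).filter fun S => G.WalkAvoiding S (G.cluster Sᶜ b) c a

/-- Membership in `rcSrcAll`. -/
theorem mem_rcSrcAll {S : Config E} : S ∈ G.rcSrcAll a b c ↔ G.IsRcSrc a b c (G.bareOf a b S) S := by
  classical
  unfold rcSrcAll
  rw [mem_filter]
  exact and_iff_right (mem_univ _)

open Classical in
/-- The fibre of the bare part among the `Good_a` sources is `rcGoodA`. -/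
theorem filter_bareOf_eq_rcGoodA (S₀ : Config E) :
    (G.rcGoodAAll a b c).filter (fun S => G.bareOf a b S = G.bareOf a b S₀) = G.rcGoodA a b c (G.bareOf a b S₀) := by
  ext S
  rw [mem_filter, mem_rcGoodA, ← mem_rcSrcSet, ← filter_bareOf_eq_rc a b c S₀, mem_filter]
  unfold rcGoodAAll
  rw [mem_filter]
  tauto

open Classical in
/-- The fibre of the bare part among the `Good_b` sources is `rcGoodB`. -/
theorem filter_bareOf_eq_rcGoodB (S₀ : Config E) :
    (G.rcGoodBAll a b c).filter (fun S => G.bareOf a b S = G.bareOf a b S₀) = G.rcGoodB a b c (G.bareOf a b S₀) := by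
  ext S
  rw [mem_filter, mem_rcGoodB, ← mem_rcSrcSet, ← filter_bareOf_eq_rc a b c S₀, mem_filter]
  unfold rcGoodBAll
  rw [mem_filter]
  tauto

omit [Fintype V] [Fintype E] [DecidableEq E] in
/-- With the probe adjacent to `a`, every source is `Good_b`: the (red) edge `c a` avoids the blue cluster of `b`. -/
theorem goodB_of_adj_a {S : Config E} (hS : (G.Conn S c a ∧ G.Conn S c b) ∧
    (¬ G.Conn Sᶜ c a ∧ ¬ G.Conn Sᶜ c b ∧ ¬ G.Conn Sᶜ a b)) {e : E} (he : G.Joins e c a) :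
    G.WalkAvoiding S (G.cluster Sᶜ b) c a := by
  obtain ⟨_, hca', hcb', hab'⟩ := hS
  have hred : S e = true := by
    cases h : S e
    · exfalso
      exact hca' (Conn.of_openAdj ⟨e, by rw [compl_apply_not, h]; rfl, he⟩)
    · rfl
  exact ⟨fun h => hcb' ((G.mem_cluster).1 h).symm,
    Relation.ReflTransGen.single ⟨⟨e, hred, he⟩, fun h => hab' ((G.mem_cluster).1 h).symm⟩⟩

omit [Fintype V] [Fintype E] [DecidableEq E] in
/-- With the probe adjacent to `b`, every source is `Good_a`. -/
theorem goodA_of_adj_b {S : Config E} (hS : (G.Conn S c a ∧ G.Conn S c b) ∧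
    (¬ G.Conn Sᶜ c a ∧ ¬ G.Conn Sᶜ c b ∧ ¬ G.Conn Sᶜ a b)) {e : E} (he : G.Joins e c b) :
    G.WalkAvoiding S (G.cluster Sᶜ a) c b := by
  obtain ⟨_, hca', hcb', hab'⟩ := hS
  have hred : S e = true := by
    cases h : S e
    · exfalso
      exact hcb' (Conn.of_openAdj ⟨e, by rw [compl_apply_not, h]; rfl, he⟩)
    · rfl
  exact ⟨fun h => hca' ((G.mem_cluster).1 h).symm,
    Relation.ReflTransGen.single ⟨⟨e, hred, he⟩, fun h => hab' ((G.mem_cluster).1 h)⟩⟩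

open Classical in
/-- With the probe adjacent to a terminal, every source is Good on one fixed side, so (CS) holds. -/
theorem rc_cs_all_of_adj (hadj : ∃ e, G.Joins e c a ∨ G.Joins e c b) :
    CS #(G.rcSrcAll a b c) #(G.rcGoodAAll a b c) #(G.rcGoodBAll a b c) := by
  apply cs_of_le
  obtain ⟨e, he | he⟩ := hadj
  · have hsub : G.rcSrcAll a b c ⊆ G.rcGoodBAll a b c := by
      intro S hS
      unfold rcGoodBAll
      rw [mem_filter]
      refine ⟨hS, ?_⟩
      rw [mem_rcSrcAll] at hS
      exact goodB_of_adj_a a b c hS.2.2 he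
    have := card_le_card hsub
    omega
  · have hsub : G.rcSrcAll a b c ⊆ G.rcGoodAAll a b c := by
      intro S hS
      unfold rcGoodAAll
      rw [mem_filter]
      refine ⟨hS, ?_⟩
      rw [mem_rcSrcAll] at hS
      exact goodA_of_adj_b a b c hS.2.2 he
    have := card_le_card hsub
    omega

open Classical in
/-- **THEOREM R-CS ON SKELETONS** (mine-3, C-041.md §17 (a)): on every skeleton with an edge between the terminals,
`c ≠ a, b` and `a ≠ b`, CONJECTURE (CS) holds on the sources all of whose attached zones are internally
red-connected: `(#rcSrcAll − #Good_a − #Good_b)₊² ≤ #Good_a · #Good_b` — per bare colouring by `rc_cs_of_bare`, then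
the CAUCHY–SCHWARZ sum over the colourings; with the probe adjacent to a terminal by `rc_cs_all_of_adj`. -/
theorem rc_cs (hca : c ≠ a) (hcb : c ≠ b) (hne : a ≠ b) (habE : ∃ e, G.Joins e a b) :
    CS #(G.rcSrcAll a b c) #(G.rcGoodAAll a b c) #(G.rcGoodBAll a b c) := by
  by_cases hadj : ∃ e, G.Joins e c a ∨ G.Joins e c b
  · exact rc_cs_all_of_adj a b c hadj
  have hc : ∀ e, ¬ G.Joins e c a ∧ ¬ G.Joins e c b :=
    fun e => ⟨fun h => hadj ⟨e, Or.inl h⟩, fun h => hadj ⟨e, Or.inr h⟩⟩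
  rw [card_eq_sum_card_fiberwise (s := G.rcSrcAll a b c) (f := G.bareOf a b) (t := univ) fun _ _ => mem_univ _,
    card_eq_sum_card_fiberwise (s := G.rcGoodAAll a b c) (f := G.bareOf a b) (t := univ) fun _ _ => mem_univ _,
    card_eq_sum_card_fiberwise (s := G.rcGoodBAll a b c) (f := G.bareOf a b) (t := univ) fun _ _ => mem_univ _]
  apply cs_of_fibres
  intro O _
  by_cases h : ((G.rcSrcAll a b c).filter fun S => G.bareOf a b S = O).Nonempty
  · obtain ⟨S₀, hS₀⟩ := h
    rw [mem_filter] at hS₀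
    rw [← hS₀.2, filter_bareOf_eq_rc a b c S₀, filter_bareOf_eq_rcGoodA a b c S₀, filter_bareOf_eq_rcGoodB a b c S₀]
    exact rc_cs_of_bare hca hcb hc hne habE _
  · rw [Finset.not_nonempty_iff_eq_empty] at h
    rw [h, card_empty]
    exact cs_of_le (Nat.zero_le _)

end All

end MultiGraph

end PercRepro
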